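import Summits.QuantumFields.BalabanUV.T4Continuum.Support.TorusBlockRefinement
import Summits.QuantumFields.BalabanUV.T4Continuum.Spine.NE1p.DressedSmallFieldFamilyAmplitudeFaces

/-!
# T⁴ programme, spine estimate NE1′ (node O3b/H2) — THE TWO-TORI FACES WITH THE L-REFINEMENT SUPPLIED: S34 PART 2's families
# END and S39's radii ∕ μ-families ENDs at `M := L·N`, `foot := trefineDom L N` (the CONSTRUCTED block refinement), their displayed
# `hmono` DISCHARGED by [Dimock2013] Lemma 10's exact coarsening (`TorusBlockRefinement.torusTreeLen_le_trefine`)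

Cell `pub-balaban`, sub-cell `t4`, BINDER-OWNERS row NE1′ (owner lineage t4-ne1p-p1); crew seat `b2b-balaban-t4-ne1p-formalise-leaf-05`
(LEAF PROVER 05, generation 11); crew row S43 ∕ DAG N29zzu «THE L-REFINEMENT BETWEEN THE TWO TORI, CONSTRUCTED» PART 2 (INTENT
`CLAIMS.log` 2026-08-20 l.19903, BOOKED typer R-T126 l.19928; X-read X168).  ADDITIVE — imports PART 1 `Support/TorusBlockRefinement` (our construction: `trefine`, `trefineDom`,
`tFaceConnected_trefine`, `image_tcoarse_trefine`, `torusTreeLen_le_trefine`) and S39 `Spine/NE1p/DressedSmallFieldFamilyAmplitudeFaces`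
(⇒ S34 PART 2 `DressedSmallFieldCoveringFamiliesFaces`, the owner's N0s∕N0t) ONLY; THEOREMS ONLY (0 `def`, 0 `def … : Prop`); nothing of
S34∕S39∕N0s∕N0t∕pv22 restated — their declarations are used BY NAME.

WHY THIS FILE.  S34 PART 2 and S39 state N0s §4's families END and N0t's radii ∕ μ-families ENDs on TWO tori — the step geometry
`tgeometry 4 N` and the scale-`k` geometry `tgeometry 4 M` — and DISPLAY the footprint map `foot : (tsys 4 N).Dom → (tsys 4 M).Dom` with
`hmono : torusTreeLen Z.1 ≤ torusTreeLen (foot Z).1`; the typer's rider: «the L-refinement between the two tori is NOT constructed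
here».  With PART 1 it IS constructed for `M = L·N`: `foot := trefineDom L N` (Z ↦ the L⁴ fine cubes of its blocks, a torus
localization domain of the fine torus) and `hmono := torusTreeLen_le_trefine` (exact coarsening, pv22's cite-tagged
`TreeLengthTorusTransfer.mul_torusTreeLen_image_le` BY NAME, `L ≥ 1`).  THIS FILE re-fires the three two-tori ENDs ONCE each with these
two binders SUPPLIED: `attachedPart_locE_le_of_coresAt_pencil_families_refined` (S34.2), `attachedPart_locE_le_of_coresAt_pencil_radii_
refined` and `muPart_locE_le_of_coresAt_pencil_families_refined` (S39).  Every other binder VERBATIM the two-tori faces': the operator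
letters `hm`∕`hN`∕`hq`, room, class radii, `hscale`∕`hact`, the located step clauses, (2.29)'s located clauses `hκ`∕`h229`,
`hterms : terms Z ⊆ coveringFamilies univ (·.1) (trefineDom L N Z).1` (the terms of `Z` ARE covering families of the REFINED footprint —
(B1b) READING, displayed), (B3-amp) `hAmp` ∕ (B3-form) `hform` + (B3-arith) `hRδ`∕`hclause`∕`hamp`, N0m's `hϱ`∕`hϱA`.
WHAT THIS DOES AND DOES NOT DO.  It removes `foot`∕`hmono` from the displayed list of the two-tori faces by a CONSTRUCTION (factor 1 of
the (2.36)-KIND direction; in fact `L·d_{k+1}(Z) ≤ d_k(refined Z)`, PART 1 `mul_torusTreeLen_le_trefine`).  It does NOT touch (B1b)'s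
`hterms`, (B3-amp)∕(B3-form)∕(B3-arith), the operator letters, the class radii or the clause SHAPES; WHICH pair `(N, L·N)` of nested
tori is Bałaban's `(𝐃_{k+1}, 𝐃_k)` (and `L` his scaling integer) stays pv22's READING (DIVERGENCE D-pv22.3), not asserted; 0 binders
instantiated on Bałaban's densities; no wall item moves; the wall line (v1.7 of record, T4-DAG v46) does NOT move; R-t4r2-Q2 NOT met.
HONEST FRAMING.  Kernel bookkeeping + one lattice construction; the cores ∕ covering families ∕ radius letters are the cell's typed FORMAT
of (2.14)∕(2.15)∕(2.18), NOT Bałaban's functions; printed loci ([Balaban1988RGII] (2.14) p. 15, (2.18) p. 16, (2.27)–(2.29) p. 18, (2.36)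
p. 19; [Balaban1987RGI] p. 251, p. 257; [Dimock2013] §3 Lemma 10) are TYPE ∕ CONTEXT through the imported cite-tagged Literature
modules, re-asserted nowhere; ABSOLUTE RULE honoured ([folklore] kernel lemmas only).  NE1′ ⇐ the named binders — NOT printed, NOT
proved; spine PROVED 0∕9; count 9 unchanged.  Rung (B)+1 on ONE finite four-torus — NOT infinite volume, NOT a mass gap, NOT OS on ℝ⁴,
NOT Clay.  HONEST DEPENDENCY: continuum YM on T⁴ ⇐ BetaPertH ∧ nine spine estimates (0/9 proved); BetaPertH ⇐ (D1) ∧ (D4) ∧ CAP+tail;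
G-an2-4 gates asym, D1 and NE2/3/4.
-/
noncomputable section

namespace Summit.QuantumFields.BalabanUV.T4Continuum.NE1p.DressedSmallFieldRefinedFaces

open Metric Set Complex MeasureTheory
open scoped BigOperators
open Literature.MathematicalPhysics.QuantumFieldTheory.Balaban1983to89.T4OutputRate (Carriers)
open Literature.MathematicalPhysics.QuantumFieldTheory.Balaban1983to89.B13Resummation (locE)
open Literature.MathematicalPhysics.QuantumFieldTheory.Balaban1983to89.B13FamilySum (coveringFamilies)
open Literature.MathematicalPhysics.QuantumFieldTheory.Balaban1983to89.TreeLengthTorus (tsys torusTreeLen)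
open Literature.MathematicalPhysics.QuantumFieldTheory.Balaban1983to89.TreeLengthTorusGeometry (TTouch)
open Literature.MathematicalPhysics.QuantumFieldTheory.Balaban1983to89.B12TreeDecay (K₀)
open Summit.QuantumFields.BalabanUV.T4Continuum.B13HistMeasurable (MeasPotFrame B13HistM)
open Summit.QuantumFields.BalabanUV.T4Continuum.B13TermParamGaussianBi (BiCore)
open Summit.QuantumFields.BalabanUV.T4Continuum.TorusBlockRefinement (trefineDom torusTreeLen_le_trefine)
open Summit.QuantumFields.BalabanUV.T4Continuum.NE1p.DressedSmallFieldCoveringFamiliesFaces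
  (attachedPart_locE_le_of_coresAt_pencil_families_torus)
open Summit.QuantumFields.BalabanUV.T4Continuum.NE1p.DressedSmallFieldFamilyAmplitudeFaces
  (muPart_locE_le_of_coresAt_pencil_families_torus attachedPart_locE_le_of_coresAt_pencil_radii_torus)

variable {N : ℕ} [NeZero N] {L : ℕ} [NeZero L]
variable {C : Carriers} {P : MeasPotFrame C} {Op : Type*} [NormedAddCommGroup Op] [NormedSpace ℂ Op]
  {𝒴 : ℕ → Finset (tsys 4 (L * N)).Dom → Type*} {dom : ∀ k i, 𝒴 k i → C.Dom} {β : ℕ → Finset (tsys 4 (L * N)).Dom → Type*}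
  [∀ k i, MeasurableSpace (β k i)] {α : ℕ → Finset (tsys 4 (L * N)).Dom → Type*} [∀ k i, NormedAddCommGroup (α k i)]
  [∀ k i, InnerProductSpace ℝ (α k i)] [∀ k i, FiniteDimensional ℝ (α k i)] [∀ k i, MeasurableSpace (α k i)]
  [∀ k i, BorelSpace (α k i)]

open Classical in
/-- **N0s §4's FAMILIES END ON THE NESTED TORI `(N, L·N)` WITH THE REFINEMENT SUPPLIED** (kernel; S34 PART 2's
`attachedPart_locE_le_of_coresAt_pencil_families_torus` ONCE at `M := L·N`, `foot := trefineDom L N`, `hmono := torusTreeLen_le_trefine`):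
cores indexed by families of fine-torus domains, the terms of `Z` covering families of the REFINED footprint `(trefineDom L N Z).1`
(`hterms`, (B1b) READING), the per-family AMPLITUDE `hAmp`, (2.29)'s located clauses, the located step clauses, N0m's `hϱ`∕`hϱA` — NO
footprint map and NO `hmono` among the binders: the attached part is `≤ 4·(e·9·64·K₀(64,8)²)·A₁·e^{−r₁·torusTreeLen X₀}`. [folklore] -/
theorem attachedPart_locE_le_of_coresAt_pencil_families_refined {W : Set (ℕ → ℝ)}
    {ctr : ℕ → (ℕ → ℝ) → C.BgB → Op × B13HistM P} {ROp RHist R' : ℕ → ℝ}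
    (𝔊 : ∀ k i, C.Dom → BiCore P (dom k i) Op (β k i) (α k i)) {mq bq N₀ : ℕ → Finset (tsys 4 (L * N)).Dom → C.Dom → ℝ}
    (hroom : ∀ k, ROp k < R' k)
    (hm : ∀ k, ∀ g ∈ W, ∀ (U : C.BgB) (X : C.Dom), C.scale X = k → ∀ i, 0 < mq k i X)
    (hN : ∀ k, ∀ g ∈ W, ∀ (U : C.BgB) (X : C.Dom), C.scale X = k → ∀ i,
      (∀ o ∈ ball (ctr k g U).1 (R' k), AEStronglyMeasurable ((𝔊 k i X).N o) (𝔊 k i X).lam) ∧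
      (∀ p, DifferentiableOn ℂ (fun o => (𝔊 k i X).N o p) (ball (ctr k g U).1 (R' k))) ∧
      (∀ o ∈ ball (ctr k g U).1 (R' k), ∀ p, ‖(𝔊 k i X).N o p‖ ≤ N₀ k i X))
    (hq : ∀ k, ∀ g ∈ W, ∀ (U : C.BgB) (X : C.Dom), C.scale X = k → ∀ i,
      (∀ o ∈ ball (ctr k g U).1 (R' k),
        AEStronglyMeasurable (Function.uncurry ((𝔊 k i X).q o)) ((𝔊 k i X).lam.prod volume)) ∧
      (∀ p v, DifferentiableOn ℂ (fun o => (𝔊 k i X).q o p v) (ball (ctr k g U).1 (R' k))) ∧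
      (∀ o ∈ ball (ctr k g U).1 (R' k), ∀ p v, mq k i X * ‖v‖ ^ 2 - bq k i X ≤ ((𝔊 k i X).q o p v).re))
    {k : ℕ} {g : ℕ → ℝ} (hg : g ∈ W) {U : C.BgB} {o : Op} {h₀ w : B13HistM P} {ϱ : ℝ}
    (hO : ‖o - (ctr k g U).1‖ ≤ ROp k) (hH : ‖h₀ - (ctr k g U).2‖ + ϱ * ‖w‖ ≤ RHist k)
    {emb : (tsys 4 N).Dom → C.Dom} (hscale : ∀ Z, C.scale (emb Z) = k)
    {terms : (tsys 4 N).Dom → Finset (Finset (tsys 4 (L * N)).Dom)} {act : ℂ → (tsys 4 N).Dom → ℂ}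
    (hact : ∀ s ∈ ball (0 : ℂ) ϱ, ∀ Z, act s Z = ∑ i ∈ terms Z, (𝔊 k i (emb Z)).termAt o (h₀ + s • w))
    {A₀ A₁ R r₁ : ℝ} (X₀ : (tsys 4 N).Dom) (hA₀ : 0 ≤ A₀) (hA₁ : 0 ≤ A₁) (hr₁ : 0 ≤ r₁)
    (hrate : r₁ + 2 * (64 * Real.log 162) + 2 ≤ R)
    (hsmall : (A₀ + ϱ * A₁) * Real.exp (5 * r₁ + 1) * K₀ 64 8 * 9 * 64 ≤ 1) {δ κ α₆ : ℝ}
    (hα₆ : 0 ≤ α₆) (hκ : 64 * Real.log 162 + 1 ≤ δ * κ) (h229 : Real.exp 1 * K₀ 64 8 * 64 * α₆ ≤ 1)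
    (hterms : ∀ Z, terms Z ⊆ coveringFamilies Finset.univ (fun Y : (tsys 4 (L * N)).Dom => Y.1) (trefineDom L N Z).1)
    (hAmp : ∀ Z : (tsys 4 N).Dom, Z.1 ⊆ X₀.1 → ∀ Df ∈ terms Z,
      (𝔊 k Df (emb Z)).lam.real univ * ((𝔊 k Df (emb Z)).wB * N₀ k Df (emb Z) * Real.exp (bq k Df (emb Z))) *
          (Real.pi / (mq k Df (emb Z) / 2)) ^ (Module.finrank ℝ (α k Df) / 2 : ℝ) *
        Real.exp ((𝔊 k Df (emb Z)).N₁ * (‖h₀‖ + ϱ * ‖w‖)) ≤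
      (A₀ + ϱ * A₁) *
        ∏ Y ∈ Df, (α₆ * Real.exp (-(δ * κ * torusTreeLen Y.1)) * Real.exp (-(R * (torusTreeLen Y.1 + 5)))))
    (hϱ : 2 ≤ ϱ) (hϱA : A₀ ≤ ϱ * A₁) :
    ‖locE (TTouch (d := 4) (N := N)) (fun Z : (tsys 4 N).Dom => Z.1) (act 1) X₀.1 -
        locE (TTouch (d := 4) (N := N)) (fun Z : (tsys 4 N).Dom => Z.1) (act 0) X₀.1‖ ≤
      4 * (Real.exp 1 * 9 * 64 * K₀ 64 8 ^ 2) * A₁ * Real.exp (-(r₁ * torusTreeLen X₀.1)) :=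
  attachedPart_locE_le_of_coresAt_pencil_families_torus 𝔊 hroom hm hN hq hg hO hH hscale hact X₀ hA₀ hA₁ hr₁ hrate hsmall
    (trefineDom L N) (fun Z => torusTreeLen_le_trefine Z) hα₆ hκ h229 hterms hAmp hϱ hϱA

open Classical in
/-- **N0t's RADII END ON THE NESTED TORI `(N, L·N)` WITH THE REFINEMENT SUPPLIED** (kernel; S39's
`attachedPart_locE_le_of_coresAt_pencil_radii_torus` ONCE at `M := L·N`, `foot := trefineDom L N`, `hmono := torusTreeLen_le_trefine`): the
(2.15)∕(2.18)-FORM `hform` with radius letters over the fine torus, the (2.28) clauses `hRδ`∕`hclause`, the bookkeeping `hamp`, `hterms` on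
the REFINED footprint — NO footprint map, NO `hmono`: `≤ 4·(e·9·64·K₀(64,8)²)·A₁·e^{−r₁·torusTreeLen X₀}`. [folklore] -/
theorem attachedPart_locE_le_of_coresAt_pencil_radii_refined {W : Set (ℕ → ℝ)}
    {ctr : ℕ → (ℕ → ℝ) → C.BgB → Op × B13HistM P} {ROp RHist R' : ℕ → ℝ}
    (𝔊 : ∀ k i, C.Dom → BiCore P (dom k i) Op (β k i) (α k i)) {mq bq N₀ : ℕ → Finset (tsys 4 (L * N)).Dom → C.Dom → ℝ}
    (hroom : ∀ k, ROp k < R' k)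
    (hm : ∀ k, ∀ g ∈ W, ∀ (U : C.BgB) (X : C.Dom), C.scale X = k → ∀ i, 0 < mq k i X)
    (hN : ∀ k, ∀ g ∈ W, ∀ (U : C.BgB) (X : C.Dom), C.scale X = k → ∀ i,
      (∀ o ∈ ball (ctr k g U).1 (R' k), AEStronglyMeasurable ((𝔊 k i X).N o) (𝔊 k i X).lam) ∧
      (∀ p, DifferentiableOn ℂ (fun o => (𝔊 k i X).N o p) (ball (ctr k g U).1 (R' k))) ∧
      (∀ o ∈ ball (ctr k g U).1 (R' k), ∀ p, ‖(𝔊 k i X).N o p‖ ≤ N₀ k i X))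
    (hq : ∀ k, ∀ g ∈ W, ∀ (U : C.BgB) (X : C.Dom), C.scale X = k → ∀ i,
      (∀ o ∈ ball (ctr k g U).1 (R' k),
        AEStronglyMeasurable (Function.uncurry ((𝔊 k i X).q o)) ((𝔊 k i X).lam.prod volume)) ∧
      (∀ p v, DifferentiableOn ℂ (fun o => (𝔊 k i X).q o p v) (ball (ctr k g U).1 (R' k))) ∧
      (∀ o ∈ ball (ctr k g U).1 (R' k), ∀ p v, mq k i X * ‖v‖ ^ 2 - bq k i X ≤ ((𝔊 k i X).q o p v).re))
    {k : ℕ} {g : ℕ → ℝ} (hg : g ∈ W) {U : C.BgB} {o : Op} {h₀ w : B13HistM P} {ϱ : ℝ}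
    (hO : ‖o - (ctr k g U).1‖ ≤ ROp k) (hH : ‖h₀ - (ctr k g U).2‖ + ϱ * ‖w‖ ≤ RHist k)
    {emb : (tsys 4 N).Dom → C.Dom} (hscale : ∀ Z, C.scale (emb Z) = k)
    {terms : (tsys 4 N).Dom → Finset (Finset (tsys 4 (L * N)).Dom)} {act : ℂ → (tsys 4 N).Dom → ℂ}
    (hact : ∀ s ∈ ball (0 : ℂ) ϱ, ∀ Z, act s Z = ∑ i ∈ terms Z, (𝔊 k i (emb Z)).termAt o (h₀ + s • w))
    {A₀ A₁ R r₁ : ℝ} (X₀ : (tsys 4 N).Dom) (hA₀ : 0 ≤ A₀) (hA₁ : 0 ≤ A₁) (hr₁ : 0 ≤ r₁)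
    (hrate : r₁ + 2 * (64 * Real.log 162) + 2 ≤ R)
    (hsmall : (A₀ + ϱ * A₁) * Real.exp (5 * r₁ + 1) * K₀ 64 8 * 9 * 64 ≤ 1) {δ κ α₆ θ : ℝ}
    {Gc : (tsys 4 N).Dom → ℝ} (hα₆ : 0 < α₆) (hκ : 64 * Real.log 162 + 1 ≤ δ * κ) (h229 : Real.exp 1 * K₀ 64 8 * 64 * α₆ ≤ 1)
    (hterms : ∀ Z, terms Z ⊆ coveringFamilies Finset.univ (fun Y : (tsys 4 (L * N)).Dom => Y.1) (trefineDom L N Z).1)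
    (hθ : 0 ≤ θ) (hGc : ∀ Z, 0 ≤ Gc Z) (hRδ : R + δ * κ ≤ (1 - 3 * δ) * κ) (hclause : θ * Real.exp (5 * R) ≤ α₆)
    (hamp : ∀ Z : (tsys 4 N).Dom, Z.1 ⊆ X₀.1 → Gc Z * (θ * α₆⁻¹ * Real.exp (5 * R)) ≤ A₀ + ϱ * A₁)
    (hform : ∀ Z : (tsys 4 N).Dom, Z.1 ⊆ X₀.1 → ∀ Df ∈ terms Z,
      (𝔊 k Df (emb Z)).lam.real univ * ((𝔊 k Df (emb Z)).wB * N₀ k Df (emb Z) * Real.exp (bq k Df (emb Z))) *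
          (Real.pi / (mq k Df (emb Z) / 2)) ^ (Module.finrank ℝ (α k Df) / 2 : ℝ) *
        Real.exp ((𝔊 k Df (emb Z)).N₁ * (‖h₀‖ + ϱ * ‖w‖)) ≤
      Gc Z * ∏ Y ∈ Df, θ * Real.exp (-((1 - 3 * δ) * κ * torusTreeLen Y.1)))
    (hϱ : 2 ≤ ϱ) (hϱA : A₀ ≤ ϱ * A₁) :
    ‖locE (TTouch (d := 4) (N := N)) (fun Z : (tsys 4 N).Dom => Z.1) (act 1) X₀.1 -
        locE (TTouch (d := 4) (N := N)) (fun Z : (tsys 4 N).Dom => Z.1) (act 0) X₀.1‖ ≤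
      4 * (Real.exp 1 * 9 * 64 * K₀ 64 8 ^ 2) * A₁ * Real.exp (-(r₁ * torusTreeLen X₀.1)) :=
  attachedPart_locE_le_of_coresAt_pencil_radii_torus 𝔊 hroom hm hN hq hg hO hH hscale hact X₀ hA₀ hA₁ hr₁ hrate hsmall
    (trefineDom L N) (fun Z => torusTreeLen_le_trefine Z) hα₆ hκ h229 hterms hθ hGc hRδ hclause hamp hform hϱ hϱA

open Classical in
/-- **N0t's μ-FAMILIES END ON THE NESTED TORI `(N, L·N)` WITH THE REFINEMENT SUPPLIED** (kernel; S39's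
`muPart_locE_le_of_coresAt_pencil_families_torus` ONCE at `M := L·N`, `foot := trefineDom L N`, `hmono := torusTreeLen_le_trefine`): source
pencil `h₀ + s • v` on `‖s‖ < μ₁`, the per-family AMPLITUDE `hAmp` at the table radius `‖h₀‖ + μ₁‖v‖`, `hterms` on the REFINED
footprint — NO footprint map, NO `hmono`; for `0 < μ₀ < μ₁`, `‖sμ‖ ≤ μ₀`:
`≤ e·9·64·K₀(64,8)²·A·e^{−r₁·torusTreeLen X₀}·μ₀/(μ₁ − μ₀)`. [folklore] -/
theorem muPart_locE_le_of_coresAt_pencil_families_refined {W : Set (ℕ → ℝ)}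
    {ctr : ℕ → (ℕ → ℝ) → C.BgB → Op × B13HistM P} {ROp RHist R' : ℕ → ℝ}
    (𝔊 : ∀ k i, C.Dom → BiCore P (dom k i) Op (β k i) (α k i)) {mq bq N₀ : ℕ → Finset (tsys 4 (L * N)).Dom → C.Dom → ℝ}
    (hroom : ∀ k, ROp k < R' k)
    (hm : ∀ k, ∀ g ∈ W, ∀ (U : C.BgB) (X : C.Dom), C.scale X = k → ∀ i, 0 < mq k i X)
    (hN : ∀ k, ∀ g ∈ W, ∀ (U : C.BgB) (X : C.Dom), C.scale X = k → ∀ i,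
      (∀ o ∈ ball (ctr k g U).1 (R' k), AEStronglyMeasurable ((𝔊 k i X).N o) (𝔊 k i X).lam) ∧
      (∀ p, DifferentiableOn ℂ (fun o => (𝔊 k i X).N o p) (ball (ctr k g U).1 (R' k))) ∧
      (∀ o ∈ ball (ctr k g U).1 (R' k), ∀ p, ‖(𝔊 k i X).N o p‖ ≤ N₀ k i X))
    (hq : ∀ k, ∀ g ∈ W, ∀ (U : C.BgB) (X : C.Dom), C.scale X = k → ∀ i,
      (∀ o ∈ ball (ctr k g U).1 (R' k),
        AEStronglyMeasurable (Function.uncurry ((𝔊 k i X).q o)) ((𝔊 k i X).lam.prod volume)) ∧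
      (∀ p v, DifferentiableOn ℂ (fun o => (𝔊 k i X).q o p v) (ball (ctr k g U).1 (R' k))) ∧
      (∀ o ∈ ball (ctr k g U).1 (R' k), ∀ p v, mq k i X * ‖v‖ ^ 2 - bq k i X ≤ ((𝔊 k i X).q o p v).re))
    {k : ℕ} {g : ℕ → ℝ} (hg : g ∈ W) {U : C.BgB} {o : Op} {h₀ v : B13HistM P} {μ₁ : ℝ}
    (hO : ‖o - (ctr k g U).1‖ ≤ ROp k) (hH : ‖h₀ - (ctr k g U).2‖ + μ₁ * ‖v‖ ≤ RHist k)
    {emb : (tsys 4 N).Dom → C.Dom} (hscale : ∀ Z, C.scale (emb Z) = k)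
    {terms : (tsys 4 N).Dom → Finset (Finset (tsys 4 (L * N)).Dom)} {act : ℂ → (tsys 4 N).Dom → ℂ}
    (hact : ∀ s ∈ ball (0 : ℂ) μ₁, ∀ Z, act s Z = ∑ i ∈ terms Z, (𝔊 k i (emb Z)).termAt o (h₀ + s • v))
    {A R r₁ μ₀ : ℝ} (X₀ : (tsys 4 N).Dom) {sμ : ℂ} (hA : 0 ≤ A) (hr₁ : 0 ≤ r₁)
    (hrate : r₁ + 2 * (64 * Real.log 162) + 2 ≤ R) (hsmall : A * Real.exp (5 * r₁ + 1) * K₀ 64 8 * 9 * 64 ≤ 1) {δ κ α₆ : ℝ}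
    (hα₆ : 0 ≤ α₆) (hκ : 64 * Real.log 162 + 1 ≤ δ * κ) (h229 : Real.exp 1 * K₀ 64 8 * 64 * α₆ ≤ 1)
    (hterms : ∀ Z, terms Z ⊆ coveringFamilies Finset.univ (fun Y : (tsys 4 (L * N)).Dom => Y.1) (trefineDom L N Z).1)
    (hAmp : ∀ Z : (tsys 4 N).Dom, Z.1 ⊆ X₀.1 → ∀ Df ∈ terms Z,
      (𝔊 k Df (emb Z)).lam.real univ * ((𝔊 k Df (emb Z)).wB * N₀ k Df (emb Z) * Real.exp (bq k Df (emb Z))) *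
          (Real.pi / (mq k Df (emb Z) / 2)) ^ (Module.finrank ℝ (α k Df) / 2 : ℝ) *
        Real.exp ((𝔊 k Df (emb Z)).N₁ * (‖h₀‖ + μ₁ * ‖v‖)) ≤
      A * ∏ Y ∈ Df, (α₆ * Real.exp (-(δ * κ * torusTreeLen Y.1)) * Real.exp (-(R * (torusTreeLen Y.1 + 5)))))
    (h0 : 0 < μ₀) (h01 : μ₀ < μ₁) (hμ : ‖sμ‖ ≤ μ₀) :
    ‖locE (TTouch (d := 4) (N := N)) (fun Z : (tsys 4 N).Dom => Z.1) (act sμ) X₀.1 -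
        locE (TTouch (d := 4) (N := N)) (fun Z : (tsys 4 N).Dom => Z.1) (act 0) X₀.1‖ ≤
      Real.exp 1 * 9 * 64 * K₀ 64 8 ^ 2 * A * Real.exp (-(r₁ * torusTreeLen X₀.1)) * (μ₀ / (μ₁ - μ₀)) :=
  muPart_locE_le_of_coresAt_pencil_families_torus 𝔊 hroom hm hN hq hg hO hH hscale hact X₀ hA hr₁ hrate hsmall
    (trefineDom L N) (fun Z => torusTreeLen_le_trefine Z) hα₆ hκ h229 hterms hAmp h0 h01 hμ

end Summit.QuantumFields.BalabanUV.T4Continuum.NE1p.DressedSmallFieldRefinedFaces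

end
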